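import Literature.AlgebraicGeometry.Frobenioids.ElementaryIsos
import HarnessLib

/-!
# Frobenioids I, Proposition 1.5 — part 2: the types of the objects of `F_Φ` and clauses
# (i)–(iii) of Definition 1.3 (STEP-0 calibration fragment of the abc-iut cell — proof genre)

Mochizuki, *The geometry of Frobenioids I: the general theory*, Kyushu J. Math. **62** (2008)
293–400, §1, Proposition 1.5 "(Elementary Frobenioids are Frobenioids)" and its proof, kurims
text p. 27 [cite: MochizukiFrdI2008, Prop. 1.5]:

> "(i) `F_Φ`, equipped with the natural functor `F_Φ → F_{Φ^char}`, is a Frobenioid of Aut-ample,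
> Aut^sub-ample, End-ample, base-trivial, Frobenius-trivial, Frobenius-normalized, and isotropic
> type."

Part 2: every object of `F_Φ` is Aut-ample, Aut^sub-ample, End-ample, base-trivial,
Frobenius-trivial, Frobenius-normalized and isotropic, and clauses (i)(a)–(c), (ii), (iii)(a)–(d) of
Def. 1.3 for `F_Φ → F_{Φ^char}`, each an explicit computation with triples `(Base, Div, deg_Fr)`
(faithfulness/fullness in (i)(c) are the formal facts of `PreFrobenioidPullbacks.lean`).
Hypotheses are kept minimal clause by clause (integrality of the `Φ(A)` only where cancellation is
used). Part 3 (clauses (iv)–(vii), the theorem, Prop. 1.5 (iii)): `ElementaryIsFrobenioid.lean`.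
No statement of the paper is strengthened.
-/

namespace Literature.AlgebraicGeometry.Frobenioids

open CategoryTheory Opposite

universe w v v' u u'

namespace ElemFrobenioid

variable {D : Type u} [Category.{v} D] {Φ : Dᵒᵖ ⥤ CommMonCat.{w}}

/-! ### Proposition 1.5 (i): the types of the objects of `F_Φ` -/

/-- Every object of `F_Φ` is Frobenius-trivial (via `ζ_A`). [cite: MochizukiFrdI2008, Prop. 1.5] -/
theorem isFrobeniusTrivial (A : ElemFrobenioid Φ) :
    PreFrobenioid.IsFrobeniusTrivial (toChar Φ) A := by
  refine ⟨frobeniusSection A, fun n => ⟨rfl, rfl, ⟨isCoAngular _, ?_⟩, ?_⟩⟩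
  · exact Associates.mk_one
  · show IsIso (𝟙 A.base)
    infer_instance

/-- Every object of `F_Φ` is Frobenius-normalized (`Φ(A)` is commutative).
[cite: MochizukiFrdI2008, Prop. 1.5] -/
theorem isFrobeniusNormalized (A : ElemFrobenioid Φ) :
    PreFrobenioid.IsFrobeniusNormalized (toChar Φ) A := by
  intro φ hφ α hα
  have hφb : Base φ = 𝟙 A.base := hφ
  have hαb : Base (show A ⟶ A from α) = 𝟙 A.base := hα.1
  have hαd : degFr (show A ⟶ A from α) = 1 := hα.2
  obtain ⟨h1, h2, h3⟩ := end_pow_eq α hαb hαd (degFr φ : ℕ)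
  refine Hom.ext ?_ ?_ ?_
  · show Base φ ≫ Base (show A ⟶ A from α ^ (degFr φ : ℕ)) = Base (show A ⟶ A from α) ≫ Base φ
    rw [h1, hαb, hφb]
  · show pull Φ (Base φ) (Div (show A ⟶ A from α ^ (degFr φ : ℕ))) *
        Div φ ^ (degFr (show A ⟶ A from α ^ (degFr φ : ℕ)) : ℕ) =
      pull Φ (Base (show A ⟶ A from α)) (Div φ) * Div (show A ⟶ A from α) ^ (degFr φ : ℕ)
    rw [hφb, pull_id, h2, h3, PNat.one_coe, pow_one, hαb, pull_id, mul_comm]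
  · show degFr φ * degFr (show A ⟶ A from α ^ (degFr φ : ℕ)) = degFr (show A ⟶ A from α) * degFr φ
    rw [h3, hαd, mul_one, one_mul]

/-- Every object of `F_Φ` is `Aut`-ample: `f ↦ (f, 0, 1)`. [cite: MochizukiFrdI2008, Prop. 1.5] -/
theorem isAutAmple (A : ElemFrobenioid Φ) : PreFrobenioid.IsAutAmple (toChar Φ) A := by
  intro f
  let g : A.base ⟶ A.base := f.hom
  haveI : IsIso g := inferInstanceAs (IsIso f.hom)
  haveI : IsIso (homMk g (1 : Φ.obj (op A.base)) 1 : A ⟶ A) := isIso_homMk (A := A) (B := A) g isUnit_one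
  exact ⟨asIso (homMk g (1 : Φ.obj (op A.base)) 1), Iso.ext rfl⟩

/-- Every object of `F_Φ` is `Aut^sub`-ample: sub-automorphisms of `A_D` lift along `f ↦ (f, 0, 1)`.
[cite: MochizukiFrdI2008, Prop. 1.5] -/
theorem isAutSubAmple (A : ElemFrobenioid Φ) : PreFrobenioid.IsAutSubAmple (toChar Φ) A := by
  rintro f ⟨B₀, φ₀, β₀, hf⟩
  let f₁ : A.base ⟶ A.base := f
  let φ₁ : B₀ ⟶ A.base := φ₀
  haveI : IsIso (homMk β₀.hom (1 : Φ.obj (op B₀)) 1 : of Φ B₀ ⟶ of Φ B₀) :=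
    isIso_homMk (A := of Φ B₀) (B := of Φ B₀) β₀.hom isUnit_one
  refine ⟨homMk f₁ 1 1, ⟨of Φ B₀, homMk φ₁ 1 1, asIso (homMk β₀.hom (1 : Φ.obj (op B₀)) 1),
    Hom.ext hf ?_ rfl⟩, rfl⟩
  show pull Φ β₀.hom (1 : Φ.obj (op B₀)) * (1 : Φ.obj (op B₀)) ^ ((1 : ℕ+) : ℕ) =
    pull Φ φ₁ (1 : Φ.obj (op A.base)) * (1 : Φ.obj (op B₀)) ^ ((1 : ℕ+) : ℕ)
  rw [map_one, map_one]

/-- Every object of `F_Φ` is `End`-ample: `f ↦ (f, 0, 1)`. [cite: MochizukiFrdI2008, Prop. 1.5] -/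
theorem isEndAmple (A : ElemFrobenioid Φ) : PreFrobenioid.IsEndAmple (toChar Φ) A :=
  fun f => ⟨homMk f 1 1, rfl⟩

/-- Every object of `F_Φ` is base-trivial: base isomorphisms lift to isomorphisms `(f, 0, 1)`.
[cite: MochizukiFrdI2008, Prop. 1.5] -/
theorem isBaseTrivial (A : ElemFrobenioid Φ) : PreFrobenioid.IsBaseTrivial (toChar Φ) A := by
  rintro B ⟨i⟩
  let f : B.base ⟶ A.base := i.inv
  haveI : IsIso f := inferInstanceAs (IsIso i.inv)
  haveI : IsIso (homMk f (1 : Φ.obj (op B.base)) 1 : B ⟶ A) := isIso_homMk (A := B) (B := A) f isUnit_one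
  exact ⟨asIso (homMk f (1 : Φ.obj (op B.base)) 1)⟩

/-- **FrdI Prop. 1.5 (i), types**: `F_Φ` is of Aut-ample, Aut^sub-ample, End-ample, base-trivial,
Frobenius-trivial, Frobenius-normalized and isotropic type. [cite: MochizukiFrdI2008, Prop. 1.5] -/
theorem isOfType_all :
    PreFrobenioid.IsOfType (PreFrobenioid.IsAutAmple (toChar Φ)) ∧
    PreFrobenioid.IsOfType (PreFrobenioid.IsAutSubAmple (toChar Φ)) ∧
    PreFrobenioid.IsOfType (PreFrobenioid.IsEndAmple (toChar Φ)) ∧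
    PreFrobenioid.IsOfType (PreFrobenioid.IsBaseTrivial (toChar Φ)) ∧
    PreFrobenioid.IsOfFrobeniusTrivialType (toChar Φ) ∧
    PreFrobenioid.IsOfType (PreFrobenioid.IsFrobeniusNormalized (toChar Φ)) ∧
    PreFrobenioid.IsOfIsotropicType (toChar Φ) :=
  ⟨isAutAmple, isAutSubAmple, isEndAmple, isBaseTrivial, isFrobeniusTrivial,
    isFrobeniusNormalized, isIsotropic⟩

/-! ### Proposition 1.5 (i): the clauses of Definition 1.3 for `F_Φ` -/

section Clauses

/-- Def. 1.3 (i)(a) for `F_Φ`: every object of `D` is (literally) the base of a Frobenius-trivial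
object. [cite: MochizukiFrdI2008, Prop. 1.5] -/
theorem i_a (A₀ : D) : ∃ A : ElemFrobenioid Φ, PreFrobenioid.IsFrobeniusTrivial (toChar Φ) A ∧
    Nonempty (PreFrobenioid.baseObj (toChar Φ) A ≅ A₀) :=
  ⟨of Φ A₀, isFrobeniusTrivial _, ⟨Iso.refl _⟩⟩

/-- Def. 1.3 (i)(b) for `F_Φ`: `α = Base(α, 0, 1) ∘ Base(id)⁻¹`. [cite: MochizukiFrdI2008, Prop. 1.5] -/
theorem i_b (A B : ElemFrobenioid Φ)
    (α : PreFrobenioid.baseObj (toChar Φ) A ≅ PreFrobenioid.baseObj (toChar Φ) B) :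
    ∃ (X : ElemFrobenioid Φ) (φ : X ⟶ A) (ψ : X ⟶ B), PreFrobenioid.IsPreStep (toChar Φ) φ ∧
      PreFrobenioid.IsPreStep (toChar Φ) ψ ∧
        PreFrobenioid.Base (toChar Φ) φ ≫ α.hom = PreFrobenioid.Base (toChar Φ) ψ := by
  refine ⟨A, 𝟙 A, homMk α.hom 1 1, isPreStep_id A, ⟨rfl, ?_⟩, Category.id_comp _⟩
  show IsIso α.hom
  infer_instance

/-- Def. 1.3 (i)(c) for `F_Φ`: `C^pl-bk_A → D_{A_D}` is an equivalence (faithful and full formally;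
essentially surjective via `e ↦ (e, 0, 1)`). [cite: MochizukiFrdI2008, Prop. 1.5] -/
theorem i_c (hint : ∀ A : D, IsIntegral (Φ.obj (op A))) (A : ElemFrobenioid Φ) :
    (PreFrobenioid.pullbackSliceToBase (toChar Φ) A).IsEquivalence := by
  haveI := PreFrobenioid.pullbackSliceToBase_faithful (toChar Φ) A
  haveI := PreFrobenioid.pullbackSliceToBase_full (toChar Φ) A
  haveI : (PreFrobenioid.pullbackSliceToBase (toChar Φ) A).EssSurj := by
    refine ⟨fun Y => ?_⟩
    have hpb : PreFrobenioid.IsPullbackMorphism (toChar Φ) (homMk Y.hom 1 1 : of Φ Y.left ⟶ A) :=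
      isPullbackMorphism_of_degFr_div hint _ rfl isUnit_one
    exact ⟨Over.mk (⟨homMk Y.hom 1 1, hpb⟩ :
        (⟨of Φ Y.left⟩ : PreFrobenioid.PullbackCat (toChar Φ)) ⟶ ⟨A⟩),
      ⟨Over.isoMk (Iso.refl _) (Category.id_comp _)⟩⟩
  exact {}

/-- Def. 1.3 (ii), existence, for `F_Φ`: `(id, 0, n)`. [cite: MochizukiFrdI2008, Prop. 1.5] -/
theorem ii_exists (A : ElemFrobenioid Φ) (n : ℕ+) : ∃ (B : ElemFrobenioid Φ) (φ : A ⟶ B),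
    PreFrobenioid.IsFrobeniusType (toChar Φ) φ ∧ PreFrobenioid.degFr (toChar Φ) φ = n :=
  ⟨A, homMk (𝟙 A.base) 1 n, ⟨⟨isCoAngular _, Associates.mk_one⟩,
    show IsIso (𝟙 A.base) from inferInstance⟩, rfl⟩

/-- Def. 1.3 (ii), essential uniqueness, for `F_Φ`. [cite: MochizukiFrdI2008, Prop. 1.5] -/
theorem ii_unique {A B B' : ElemFrobenioid Φ} (φ : A ⟶ B) (ψ : A ⟶ B')
    (hφ : PreFrobenioid.IsFrobeniusType (toChar Φ) φ) (hψ : PreFrobenioid.IsFrobeniusType (toChar Φ) ψ)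
    (hn : PreFrobenioid.degFr (toChar Φ) φ = PreFrobenioid.degFr (toChar Φ) ψ) :
    ∃ β : B ≅ B', φ ≫ β.hom = ψ := by
  haveI : IsIso (Base φ) := hφ.2
  haveI : IsIso (Base ψ) := hψ.2
  obtain ⟨u, hu⟩ := toChar_isIsometry_iff.mp hφ.1.2
  have hn' : degFr φ = degFr ψ := hn
  let β : B ⟶ B' := homMk (inv (Base φ) ≫ Base ψ) (pull Φ (inv (Base φ)) (Div ψ * ↑u⁻¹)) 1
  haveI : IsIso β :=
    isIso_homMk _ (((toChar_isIsometry_iff.mp hψ.1.2).mul (u⁻¹).isUnit).map _)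
  refine ⟨asIso β, Hom.ext ?_ ?_ ?_⟩
  · show Base φ ≫ inv (Base φ) ≫ Base ψ = Base ψ
    rw [IsIso.hom_inv_id_assoc]
  · show pull Φ (Base φ) (pull Φ (inv (Base φ)) (Div ψ * ↑u⁻¹)) * Div φ ^ ((1 : ℕ+) : ℕ) = Div ψ
    rw [← pull_comp, IsIso.hom_inv_id, pull_id, PNat.one_coe, pow_one, ← hu,
      Units.inv_mul_cancel_right]
  · show degFr φ * 1 = degFr ψ
    rw [mul_one, hn']

/-- Def. 1.3 (iii)(c) for `F_Φ`: a co-angular pre-step `φ : A → B` transports `O^▷(A) ≅ Φ(A)` to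
`O^▷(B) ≅ Φ(B)` along `(Base φ)⁻¹^*`. [cite: MochizukiFrdI2008, Prop. 1.5] -/
theorem iii_c {A B : ElemFrobenioid Φ} (φ : A ⟶ B)
    (h : PreFrobenioid.IsCoAngularPreStep (toChar Φ) φ) :
    ∃ e : PreFrobenioid.endSubmonoid (toChar Φ) A ≃* PreFrobenioid.endSubmonoid (toChar Φ) B,
      ∀ α : PreFrobenioid.endSubmonoid (toChar Φ) A,
        φ ≫ (show B ⟶ B from (e α).1) = (show A ⟶ A from α.1) ≫ φ := by
  haveI : IsIso (Base φ) := h.2.2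
  have hφ1 : degFr φ = 1 := h.2.1
  refine ⟨(endEquiv A).trans ((pullEquiv Φ (inv (Base φ))).trans (endEquiv B).symm), fun α => ?_⟩
  have hαb : Base (show A ⟶ A from α.1) = 𝟙 A.base := α.2.1
  have hαd : degFr (show A ⟶ A from α.1) = 1 := α.2.2
  refine Hom.ext ?_ ?_ ?_
  · show Base φ ≫ 𝟙 B.base = Base (show A ⟶ A from α.1) ≫ Base φ
    rw [hαb, Category.comp_id, Category.id_comp]
  · show pull Φ (Base φ) (pull Φ (inv (Base φ)) (Div (show A ⟶ A from α.1))) *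
        Div φ ^ ((1 : ℕ+) : ℕ) =
      pull Φ (Base (show A ⟶ A from α.1)) (Div φ) * Div (show A ⟶ A from α.1) ^ (degFr φ : ℕ)
    rw [← pull_comp, IsIso.hom_inv_id, pull_id, hαb, pull_id, hφ1, PNat.one_coe, pow_one, pow_one,
      mul_comm]
  · show degFr φ * 1 = degFr (show A ⟶ A from α.1) * degFr φ
    rw [hαd, one_mul, mul_one]

/-- Def. 1.3 (iii)(c), dependence on `Base(φ)` only, for `F_Φ`. [cite: MochizukiFrdI2008, Prop. 1.5] -/
theorem iii_c_base (hint : ∀ A : D, IsIntegral (Φ.obj (op A))) {A B : ElemFrobenioid Φ}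
    (φ φ' : A ⟶ B) (h : PreFrobenioid.IsCoAngularPreStep (toChar Φ) φ)
    (h' : PreFrobenioid.IsCoAngularPreStep (toChar Φ) φ')
    (hb : PreFrobenioid.Base (toChar Φ) φ = PreFrobenioid.Base (toChar Φ) φ')
    (α : PreFrobenioid.endSubmonoid (toChar Φ) A) (β β' : PreFrobenioid.endSubmonoid (toChar Φ) B)
    (e₁ : φ ≫ (show B ⟶ B from β.1) = (show A ⟶ A from α.1) ≫ φ)
    (e₂ : φ' ≫ (show B ⟶ B from β'.1) = (show A ⟶ A from α.1) ≫ φ') : β = β' := by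
  haveI : IsIso (Base φ) := h.2.2
  haveI : IsCancelMul (Φ.obj (op A.base)) := isIntegral_iff_isCancelMul.mp (hint A.base)
  have hb' : Base φ = Base φ' := hb
  have hφ1 : degFr φ = 1 := h.2.1
  have hφ1' : degFr φ' = 1 := h'.2.1
  have hαb : Base (show A ⟶ A from α.1) = 𝟙 A.base := α.2.1
  have hβb : Base (show B ⟶ B from β.1) = 𝟙 B.base := β.2.1
  have hβb' : Base (show B ⟶ B from β'.1) = 𝟙 B.base := β'.2.1
  have hβd : degFr (show B ⟶ B from β.1) = 1 := β.2.2
  have hβd' : degFr (show B ⟶ B from β'.1) = 1 := β'.2.2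
  have d₁ : pull Φ (Base φ) (Div (show B ⟶ B from β.1)) * Div φ ^ (degFr (show B ⟶ B from β.1) : ℕ) =
      pull Φ (Base (show A ⟶ A from α.1)) (Div φ) * Div (show A ⟶ A from α.1) ^ (degFr φ : ℕ) :=
    congrArg Hom.div e₁
  have d₂ : pull Φ (Base φ') (Div (show B ⟶ B from β'.1)) * Div φ' ^ (degFr (show B ⟶ B from β'.1) : ℕ) =
      pull Φ (Base (show A ⟶ A from α.1)) (Div φ') * Div (show A ⟶ A from α.1) ^ (degFr φ' : ℕ) :=
    congrArg Hom.div e₂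
  rw [hβd, hφ1, PNat.one_coe, pow_one, pow_one, hαb, pull_id, mul_comm] at d₁
  rw [hβd', hφ1', PNat.one_coe, pow_one, pow_one, hαb, pull_id, mul_comm, ← hb'] at d₂
  have key : Div (show B ⟶ B from β.1) = Div (show B ⟶ B from β'.1) :=
    (pullEquiv Φ (Base φ)).injective ((mul_left_cancel d₁).trans (mul_left_cancel d₂).symm)
  exact Subtype.ext (Hom.ext (hβb.trans hβb'.symm) key (hβd.trans hβd'.symm))

/-- Def. 1.3 (iii)(d), coslice, fullness, for `F_Φ`. [cite: MochizukiFrdI2008, Prop. 1.5] -/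
theorem iii_d_under_full {A B B' : ElemFrobenioid Φ} (φ : A ⟶ B) (φ' : A ⟶ B')
    (h : PreFrobenioid.IsCoAngularPreStep (toChar Φ) φ)
    (h' : PreFrobenioid.IsCoAngularPreStep (toChar Φ) φ')
    (hd : PreFrobenioid.Div (toChar Φ) φ ∣ PreFrobenioid.Div (toChar Φ) φ') :
    ∃ f : B ⟶ B', PreFrobenioid.IsCoAngularPreStep (toChar Φ) f ∧ φ ≫ f = φ' := by
  haveI : IsIso (Base φ) := h.2.2
  haveI : IsIso (Base φ') := h'.2.2
  obtain ⟨V, hV⟩ : Div φ ∣ Div φ' := Associates.mk_dvd_mk.mp hd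
  refine ⟨homMk (inv (Base φ) ≫ Base φ') (pull Φ (inv (Base φ)) V) 1, ⟨isCoAngular _, rfl, ?_⟩,
    Hom.ext ?_ ?_ ?_⟩
  · show IsIso (inv (Base φ) ≫ Base φ')
    infer_instance
  · show Base φ ≫ inv (Base φ) ≫ Base φ' = Base φ'
    rw [IsIso.hom_inv_id_assoc]
  · show pull Φ (Base φ) (pull Φ (inv (Base φ)) V) * Div φ ^ ((1 : ℕ+) : ℕ) = Div φ'
    rw [← pull_comp, IsIso.hom_inv_id, pull_id, PNat.one_coe, pow_one, hV, mul_comm]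
  · show degFr φ * 1 = degFr φ'
    rw [mul_one, show degFr φ = 1 from h.2.1, show degFr φ' = 1 from h'.2.1]

/-- Def. 1.3 (iii)(d), coslice, essential surjectivity, for `F_Φ`: `x = Div(id, x, 1)`.
[cite: MochizukiFrdI2008, Prop. 1.5] -/
theorem iii_d_under_surj (A : ElemFrobenioid Φ)
    (x : (charFunctor Φ).obj (op (PreFrobenioid.baseObj (toChar Φ) A))) :
    ∃ (B : ElemFrobenioid Φ) (φ : A ⟶ B), PreFrobenioid.IsCoAngularPreStep (toChar Φ) φ ∧
      PreFrobenioid.Div (toChar Φ) φ = x := by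
  obtain ⟨x, rfl⟩ := Associates.mk_surjective x
  exact ⟨A, homMk (𝟙 A.base) x 1, ⟨isCoAngular _, rfl, show IsIso (𝟙 A.base) from inferInstance⟩,
    rfl⟩

/-- Def. 1.3 (iii)(d), slice, fullness, for `F_Φ`. [cite: MochizukiFrdI2008, Prop. 1.5] -/
theorem iii_d_over_full {A B B' : ElemFrobenioid Φ} (ψ : B ⟶ A) (ψ' : B' ⟶ A)
    (h : PreFrobenioid.IsCoAngularPreStep (toChar Φ) ψ)
    (h' : PreFrobenioid.IsCoAngularPreStep (toChar Φ) ψ')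
    (hd : PreFrobenioid.invDiv (toChar Φ) ψ' h'.2.2 ∣ PreFrobenioid.invDiv (toChar Φ) ψ h.2.2) :
    ∃ g : B ⟶ B', PreFrobenioid.IsCoAngularPreStep (toChar Φ) g ∧ g ≫ ψ' = ψ := by
  haveI : IsIso (Base ψ) := h.2.2
  haveI : IsIso (Base ψ') := h'.2.2
  rw [toChar_invDiv, toChar_invDiv] at hd
  obtain ⟨V, hV⟩ : pull Φ (inv (Base ψ')) (Div ψ') ∣ pull Φ (inv (Base ψ)) (Div ψ) :=
    Associates.mk_dvd_mk.mp hd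
  refine ⟨homMk (Base ψ ≫ inv (Base ψ')) (pull Φ (Base ψ) V) 1, ⟨isCoAngular _, rfl, ?_⟩,
    Hom.ext ?_ ?_ ?_⟩
  · show IsIso (Base ψ ≫ inv (Base ψ'))
    infer_instance
  · show (Base ψ ≫ inv (Base ψ')) ≫ Base ψ' = Base ψ
    rw [Category.assoc, IsIso.inv_hom_id, Category.comp_id]
  · show pull Φ (Base ψ ≫ inv (Base ψ')) (Div ψ') * (pull Φ (Base ψ) V) ^ (degFr ψ' : ℕ) = Div ψ
    rw [show degFr ψ' = 1 from h'.2.1, PNat.one_coe, pow_one, pull_comp, ← map_mul, ← hV,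
      ← pull_comp, IsIso.hom_inv_id, pull_id]
  · show 1 * degFr ψ' = degFr ψ
    rw [one_mul, show degFr ψ' = 1 from h'.2.1, show degFr ψ = 1 from h.2.1]

/-- Def. 1.3 (iii)(d), slice, essential surjectivity, for `F_Φ`: `x = (id^*)⁻¹ Div(id, x, 1)`.
[cite: MochizukiFrdI2008, Prop. 1.5] -/
theorem iii_d_over_surj (A : ElemFrobenioid Φ)
    (x : (charFunctor Φ).obj (op (PreFrobenioid.baseObj (toChar Φ) A))) :
    ∃ (B : ElemFrobenioid Φ) (ψ : B ⟶ A) (h : PreFrobenioid.IsCoAngularPreStep (toChar Φ) ψ),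
      PreFrobenioid.invDiv (toChar Φ) ψ h.2.2 = x := by
  obtain ⟨x, rfl⟩ := Associates.mk_surjective x
  have h : PreFrobenioid.IsCoAngularPreStep (toChar Φ) (homMk (𝟙 A.base) x 1 : A ⟶ A) :=
    ⟨isCoAngular _, rfl, show IsIso (𝟙 A.base) from inferInstance⟩
  refine ⟨A, homMk (𝟙 A.base) x 1, h, ?_⟩
  haveI : IsIso (Base (homMk (𝟙 A.base) x 1 : A ⟶ A)) := h.2.2
  rw [toChar_invDiv]
  show Associates.mk (pull Φ (inv (𝟙 A.base)) x) = Associates.mk x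
  rw [IsIso.inv_id, pull_id]
  rfl

end Clauses

end ElemFrobenioid

end Literature.AlgebraicGeometry.Frobenioids
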